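import Mathlib
import Summits.CriticalPhenomena.PercolationContinuityZ3.Theses.PercNearOneGluing

/-!
# Sketch — crux-ideate round 2, ideator 6: `live-seal-vanishing-sprinkle`

Typed first lemmas for the idea card `Ideas/live-seal-vanishing-sprinkle.md` on crux
`PercNearOneGluing.NearOneGluing` (stmt-CriticalPhenomena-4574 = Kozma–Nitzan Conjecture 3).
Nothing here is proved; every `def … : Prop` must elaborate over existing declarations.

Notation (all over `μ = prodBernoulli w` on `Set (Sym2 (Fin n))`, events `openConn`, `openConnIn`):
* `relayFreePocket A o ω = S₀(ω)` — vertices reachable from `o` by open paths avoiding `A`;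
* `liveEdges w T₀ b ω` — pairs `s(x,y)` with `x ∈ T₀`, `y ∉ T₀` and `y ↔ b` by an open path avoiding `T₀`
  ("live" boundary pairs of `T₀`: opening one of them joins `T₀` to `b`);
* `kappa w F = ∏_{e ∈ F} (1 - w e)` — the prior probability that all pairs of `F` are closed.
-/

namespace Summit.CriticalPhenomena.PercolationContinuityZ3.Cruxes.NearOneGluing.Sketch6

open scoped BigOperators Classical
open MeasureTheory Set
open Literature.Probability.LatticeModels (prodBernoulli)
open Literature.Probability.Percolation (openConn openConnIn)

variable {n : ℕ}

/-- Prior probability that every pair of `F` is closed. -/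
noncomputable def kappa (w : Sym2 (Fin n) → unitInterval) (F : Finset (Sym2 (Fin n))) : ℝ :=
  ∏ e ∈ F, (1 - (w e : ℝ))

/-- Cost of a set of pairs: `c(F) = Σ_{e∈F} log (1/(1 - w e))` (so `kappa w F = exp (-(cost w F))`
when no weight equals `1`). -/
noncomputable def cost (w : Sym2 (Fin n) → unitInterval) (F : Finset (Sym2 (Fin n))) : ℝ :=
  ∑ e ∈ F, (-Real.log (1 - (w e : ℝ)))

/-- The relay-free pocket `S₀(ω)` of `o`: vertices joined to `o` by an open path avoiding `A`
(the stopping set of the landed `pocketBound`, written as a `Finset`). -/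
noncomputable def relayFreePocket (A : Finset (Fin n)) (o : Fin n) (ω : Set (Sym2 (Fin n))) :
    Finset (Fin n) :=
  Finset.univ.filter fun v => ω ∈ openConnIn ((↑A : Set (Fin n))ᶜ) o v

/-- LIVE boundary pairs of a vertex set `T₀` towards `b`: `s(x, y)` with `x ∈ T₀`, `y ∉ T₀`, and
`y ↔ b` by an open path using no vertex of `T₀` (hence no pair incident to `T₀`). -/
noncomputable def liveEdges (T₀ : Finset (Fin n)) (b : Fin n) (ω : Set (Sym2 (Fin n))) :
    Finset (Sym2 (Fin n)) :=
  ((T₀ ×ˢ Finset.univ).filter fun xy =>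
      xy.2 ∉ T₀ ∧ ω ∈ openConnIn ((↑T₀ : Set (Fin n))ᶜ) xy.2 b).image fun xy => s(xy.1, xy.2)

/-- Closed pivotal pairs for `{o ↔ b}` in `ω`: closed, and opening the single pair creates the
connection. -/
noncomputable def closedPivotal (o b : Fin n) (ω : Set (Sym2 (Fin n))) : Finset (Sym2 (Fin n)) :=
  Finset.univ.filter fun e => e ∉ ω ∧ ¬ e.IsDiag ∧ ω ∉ openConn o b ∧ insert e ω ∈ openConn o b

/-- **FIRST LEMMA (TransferIneq, provable now, size S–M).** For a FIXED vertex set `T₀ ∌ b`, a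
fixed set `E₀` of vertices and `a ∈ E₀`: the unreliability of `a` dominates the mass of
"`E₀` is cut from `b` off `T₀` AND every live boundary pair of `T₀` is closed", and the two
factors are independent (live-ness and the cut are read off pairs NOT incident to `T₀`; the
boundary pairs are). Deterministic core: if `a ↔ b` then the LAST pair incident to `T₀` on an
open `a–b` path is a live boundary pair, so it is open. -/
def TransferIneq : Prop :=
  ∀ (n : ℕ) (w : Sym2 (Fin n) → unitInterval) (T₀ E₀ : Finset (Fin n)) (a b : Fin n),
    a ∈ E₀ → b ∉ T₀ →
      ∫ ω, ({ω | ∀ e ∈ E₀, ω ∉ openConnIn ((↑T₀ : Set (Fin n))ᶜ) e b}.indicator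
              (fun ω => kappa w (liveEdges T₀ b ω)) ω) ∂(prodBernoulli w)
        ≤ (prodBernoulli w).real (openConn a b)ᶜ

/-- **K1 (ExposureBound, provable from `TransferIneq` + the strong Markov property at the
stopping set of pairs incident to `S₀(ω)`, size M).** Bad configurations whose relay-free
pocket has a CHEAP live seal (`κ(Live) ≥ θ`, "buffered pockets") have total mass
`≤ max_a P(a ↮ b) / θ` — uniformly in `|A|`. -/
def ExposureBound : Prop :=
  ∀ (n : ℕ) (w : Sym2 (Fin n) → unitInterval) (A : Finset (Fin n)) (o b : Fin n) (s θ : ℝ),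
    0 < θ → (∀ a ∈ A, (prodBernoulli w).real (openConn a b)ᶜ ≤ s) →
      (prodBernoulli w).real
          {ω | ω ∉ openConn o b ∧ (∃ a ∈ A, ω ∈ openConn o a) ∧
               θ ≤ kappa w (liveEdges (relayFreePocket A o ω) b ω)} ≤ s / θ

/-- **K1' (SprinkledNearOneGluing — THEOREM modulo K1, size S on top of K1).** Kozma–Nitzan's
Conjecture 3 after a VANISHING sprinkle: boosting every pair's log-failure rate by the factor
`1 + t` (`1 - w' = (1 - w)^{1+t}`), the conclusion holds with loss `max_a P(a ↮ b)^t / (1 - t)`,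
`|A|`-free. Proof: `ω ∪ ω''` with `ω''` an independent `t`-sprinkle has law `prodBernoulli w'`;
on an exposed bad `ω` (`κ(Live) < θ`) the sprinkle opens a live pair with probability
`≥ 1 - κ(Live)^t > 1 - θ^t`, which joins `o` to `b`; buffered bad `ω` has mass `≤ s/θ` (K1);
optimise `θ` (layer-cake). With `t = log(2/ε)/log(1/δ)` the loss is `≤ ε`. -/
def SprinkledNearOneGluing : Prop :=
  ∀ (t : ℝ), 0 < t → t < 1 →
    ∀ (n : ℕ) (w w' : Sym2 (Fin n) → unitInterval),
      (∀ e, (1 - (w' e : ℝ)) = (1 - (w e : ℝ)) ^ (1 + t)) →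
      ∀ (A : Finset (Fin n)) (o b : Fin n) (s : ℝ), 0 ≤ s →
        (∀ a ∈ A, (prodBernoulli w).real (openConn a b)ᶜ ≤ s) →
          (prodBernoulli w').real (openConn o b)ᶜ
            ≤ (prodBernoulli w).real (⋃ a ∈ A, openConn o a)ᶜ + s ^ t / (1 - t)

/-- **K2 (ExposedSealsRare — the residual at `t = 0`; equivalent to the crux given K1).**
Exposed bad configurations — `o`'s relay-free pocket pressed against the cluster of `b` along a
closed LIVE interface of prior probability `< √δ` (cost `> ½ log(1/δ)`) — are rare, uniformly in
`|A|`. A finite-graph "two clusters touching along an expensive closed interface" statement. -/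
def ExposedSealsRare : Prop :=
  ∀ ε : ℝ, 0 < ε → ∃ δ : ℝ, 0 < δ ∧
    ∀ (n : ℕ) (w : Sym2 (Fin n) → unitInterval) (A : Finset (Fin n)) (o b : Fin n),
      (prodBernoulli w).real (⋃ a ∈ A, openConn o a)ᶜ ≤ δ →
      (∀ a ∈ A, (prodBernoulli w).real (openConn a b)ᶜ ≤ δ) →
        (prodBernoulli w).real
            {ω | ω ∉ openConn o b ∧ (∃ a ∈ A, ω ∈ openConn o a) ∧
                 kappa w (liveEdges (relayFreePocket A o ω) b ω) < Real.sqrt δ} < ε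

/-- **K2' (ClosedPivotalBudget — a STRICTLY STRONGER, finitely computable sufficient condition
for K2).** On the bad event the live seal consists of closed pivotal pairs for `{o ↔ b}`, so by
Markov `P(exposed bad) ≤ E[cost(closed pivotals); bad, o ↔ A] / (½ log(1/δ))`; and by Russo's
formula along the boosting path this expectation is `-(d/dt) P_{w^{(1+t)}}(o ↮ b)` at `t = 0`.
Budget asked: `≤ (ε/8)·log(1/δ)`. -/
def ClosedPivotalBudget : Prop :=
  ∀ ε : ℝ, 0 < ε → ∃ δ : ℝ, 0 < δ ∧ δ < 1 ∧
    ∀ (n : ℕ) (w : Sym2 (Fin n) → unitInterval) (A : Finset (Fin n)) (o b : Fin n),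
      (∀ e, (w e : ℝ) < 1) →
      (prodBernoulli w).real (⋃ a ∈ A, openConn o a)ᶜ ≤ δ →
      (∀ a ∈ A, (prodBernoulli w).real (openConn a b)ᶜ ≤ δ) →
        ∫ ω in {ω | ω ∉ openConn o b ∧ ∃ a ∈ A, ω ∈ openConn o a},
            cost w (closedPivotal o b ω) ∂(prodBernoulli w)
          ≤ (ε / 8) * (-Real.log δ)

/-- **Russo along the boosting path (provable now, S–M; the identity behind K2').**
`t ↦ P_{w(t)}(o ↮ b)` with `1 - w(t) = (1 - w)^{1+t}` has derivative
`-E_{w(t)}[cost(closed pivotal pairs)]`; stated at `t = 0` as a `HasDerivAt`. -/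
def RussoBoost : Prop :=
  ∀ (n : ℕ) (w : Sym2 (Fin n) → unitInterval) (o b : Fin n), (∀ e, (w e : ℝ) < 1) →
    ∀ (wt : ℝ → Sym2 (Fin n) → unitInterval),
      (∀ t e, (1 - (wt t e : ℝ)) = (1 - (w e : ℝ)) ^ (1 + t)) →
        HasDerivAt (fun t => (prodBernoulli (wt t)).real (openConn o b)ᶜ)
          (-(∫ ω, cost w (closedPivotal o b ω) ∂(prodBernoulli w))) 0

/-- Glue 1 (provable now, a few lines): K1 + K2 give the crux (`δ' = min(δ_K2(ε/3), ε²/9)`;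
split the bad event into `o ↮ A`, buffered, exposed). -/
def nearOneGluing_of_exposure : Prop :=
  ExposureBound → ExposedSealsRare →
    Summit.CriticalPhenomena.PercolationContinuityZ3.Theses.PercNearOneGluing.NearOneGluing

/-- Glue 2 (provable now): the budget K2' implies K2 (Markov on the cost of the live seal, which is
a subset of the closed pivotal pairs; pairs of weight 1 are never closed so WLOG `w e < 1`). -/
def exposedSealsRare_of_budget : Prop :=
  ExposureBound → ClosedPivotalBudget → ExposedSealsRare

end Summit.CriticalPhenomena.PercolationContinuityZ3.Cruxes.NearOneGluing.Sketch6
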